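import Summits.HubbardSuperconductivity.HubbardSuperconductivity.Theorems.AnisotropyChordInsertionEntropyJastrowParticleHole
import Summits.HubbardSuperconductivity.HubbardSuperconductivity.Theorems.AnisotropyChordInsertionEntropyFourier
import Summits.HubbardSuperconductivity.HubbardSuperconductivity.Theorems.AnisotropyChordInsertionEntropySheetFluctuation

/-!
# Route `AnisotropyChord` / H0 rotor rung: the resampling route INSTANTIATED for the min-image `β/r` sheet kernel —
# `SheetKernelSpectralFloor ⟹ BEC` at every `β ≥ 0` (port of theory seat `hubbard-h0-rotor-theory-1`, Sketch9 Parts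
# P–P″ end statements `condensate_of_energyFloor'`, `condensate_of_PSD'`, `sheetKernelPSD_of_spectralFloor`,
# `condensate_of_spectralFloor`, memo ROTOR-THEORY-9 §135(t); via the kernel-generic files …JastrowResampling*)

* `jAmp (sheetFun L β 0) (L²/2) = halfSheetAmp L β`, `0 ≤ sheetFun L β 0 ≤ β`;
* Bochner on the torus (generic): `kernelFT_conv`, `quadForm_eq_sum_kernelFT`
  (`Σ_{u,v} f_u f_v W(u−v) = L⁻² Σ_k Re Ŵ(k) |f̂(k)|²`), `sum_sq_eq_sum_kernelFT` (Plancherel),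
  `kernelPSDShift_of_re_kernelFT_ge` (`Re Ŵ ≥ −D ⟹ KernelPSDShift W D`);
* `SheetEnergyFloor`, `SheetKernelPSD` (the `∀ L` forms of the generic cruxes for `W = sheetFun L β 0`,
  `N = ⌊L²/2⌋`), `sheetEnergyFloor_of_psd`, `sheetKernelPSD_of_spectralFloor` (S2(a) ⟹ PSD);
* **`condensate_of_sheetEnergyFloor`, `condensate_of_sheetKernelPSD`, `condensate_of_spectralFloor`:** the min-image
  Jastrow–sheet rung with ONE residual input, the lattice-sum inequality `SheetKernelSpectralFloor w₀`
  (`Ŵ_L(k) ≥ −w₀β`; numerically `w₀ = 1.6155…`, the 2D Madelung constant):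
  `e^{−C/2}/4 ≤ n₀/|Λ|` on every even torus, `C = resamplingConst β (w₀β)`.
(The periodic Coulomb-sheet kernel of `…InsertionEntropyCoulombSheet` needs no such input.)
-/

set_option linter.dupNamespace false

noncomputable section

open Finset Complex
open scoped ComplexConjugate
open Literature.Probability.LatticeModels

namespace Summit.HubbardSuperconductivity.HubbardSuperconductivity.Theorems.AnisotropyChord.InsertionEntropy

section Bochner

variable {L : ℕ} [NeZero L]

/-- **Convolution theorem** for the finite Fourier transform: `(W ⋆ f)^(k) = Ŵ(k) f̂(k)`.
(theory seat Sketch9 Part P″ `kernelFT_conv`) [folklore] -/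
theorem kernelFT_conv (W f : TorusSite 2 L → ℝ) (k : TorusSite 2 L) :
    kernelFT L (fun u => ∑ v, W (u - v) * f v) k = kernelFT L W k * kernelFT L f k := by
  unfold kernelFT
  calc ∑ u, (((fun u => ∑ v, W (u - v) * f v) u : ℝ) : ℂ) * torusPhase L k u
      = ∑ u, ∑ v, ((W (u - v) : ℂ) * torusPhase L k (u - v)) * ((f v : ℂ) * torusPhase L k v) := by
        refine Finset.sum_congr rfl fun u _ => ?_
        simp only [Complex.ofReal_sum, Complex.ofReal_mul]
        rw [Finset.sum_mul]
        refine Finset.sum_congr rfl fun v _ => ?_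
        have : torusPhase L k u = torusPhase L k (u - v) * torusPhase L k v := by
          rw [← torusPhase_add_right, sub_add_cancel]
        rw [this]; ring
    _ = ∑ v, (∑ u, (W (u - v) : ℂ) * torusPhase L k (u - v)) * ((f v : ℂ) * torusPhase L k v) := by
        rw [Finset.sum_comm]; exact Finset.sum_congr rfl fun v _ => by rw [Finset.sum_mul]
    _ = ∑ v, (∑ t, (W t : ℂ) * torusPhase L k t) * ((f v : ℂ) * torusPhase L k v) := by
        refine Finset.sum_congr rfl fun v _ => ?_
        congr 1
        rw [← Equiv.sum_comp (Equiv.subRight v) (fun t => (W t : ℂ) * torusPhase L k t)]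
        simp only [Equiv.subRight_apply]
    _ = (∑ t, (W t : ℂ) * torusPhase L k t) * ∑ v, (f v : ℂ) * torusPhase L k v := by rw [Finset.mul_sum]

/-- **BOCHNER ON THE TORUS (PROVED):** `Σ_{u,v} f_u f_v W(u−v) = L⁻² Σ_k Re Ŵ(k) |f̂(k)|²`.
(theory seat Sketch9 Part P″ `quadForm_eq_sum_hat`) [folklore] -/
theorem quadForm_eq_sum_kernelFT (W f : TorusSite 2 L → ℝ) :
    ∑ u, ∑ v, f u * f v * W (u - v) = (∑ k, (kernelFT L W k).re * ‖kernelFT L f k‖ ^ 2) / (L : ℝ) ^ 2 := by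
  have hquad : ∑ u, ∑ v, f u * f v * W (u - v) = ∑ u, f u * (fun u => ∑ v, W (u - v) * f v) u := by
    refine Finset.sum_congr rfl fun u _ => ?_
    simp only
    rw [Finset.mul_sum]
    exact Finset.sum_congr rfl fun v _ => by ring
  rw [hquad, sum_mul_eq_re_sum_kernelFT]
  congr 1
  rw [Complex.re_sum]
  refine Finset.sum_congr rfl fun k _ => ?_
  rw [kernelFT_conv W f k, map_mul,
    show kernelFT L f k * (conj (kernelFT L W k) * conj (kernelFT L f k))
      = conj (kernelFT L W k) * (kernelFT L f k * conj (kernelFT L f k)) by ring,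
    Complex.mul_conj, Complex.normSq_eq_norm_sq, Complex.re_mul_ofReal, Complex.conj_re]

/-- **Plancherel:** `Σ_u f_u² = L⁻² Σ_k |f̂(k)|²`. (theory seat Sketch9 Part P″ `sum_sq_eq_sum_hat`) [folklore] -/
theorem sum_sq_eq_sum_kernelFT (f : TorusSite 2 L → ℝ) :
    ∑ u, f u ^ 2 = (∑ k, ‖kernelFT L f k‖ ^ 2) / (L : ℝ) ^ 2 := by
  have h := sum_mul_eq_re_sum_kernelFT (L := L) f f
  have hre : (∑ k, kernelFT L f k * conj (kernelFT L f k)).re = ∑ k, ‖kernelFT L f k‖ ^ 2 := by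
    rw [Complex.re_sum]
    refine Finset.sum_congr rfl fun k _ => ?_
    rw [Complex.mul_conj, Complex.normSq_eq_norm_sq, Complex.ofReal_re]
  rw [← hre, ← h]
  exact Finset.sum_congr rfl fun u _ => by ring

/-- **Spectral floor ⟹ PSD with shift (PROVED):** if `Re Ŵ(k) ≥ −D` for all `k` then `KernelPSDShift W D` on `(ℤ/L)²`. [folklore] -/
theorem kernelPSDShift_of_re_kernelFT_ge (W : TorusSite 2 L → ℝ) (D : ℝ) (h : ∀ k, -D ≤ (kernelFT L W k).re) :
    KernelPSDShift W D := by
  intro f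
  have hL2 : (0 : ℝ) < (L : ℝ) ^ 2 := by
    have : (0 : ℝ) < (L : ℝ) := by exact_mod_cast Nat.pos_of_ne_zero (NeZero.ne L)
    positivity
  rw [quadForm_eq_sum_kernelFT, sum_sq_eq_sum_kernelFT, mul_div_assoc', ← add_div]
  apply div_nonneg _ hL2.le
  rw [Finset.mul_sum, ← Finset.sum_add_distrib]
  refine Finset.sum_nonneg fun k _ => ?_
  have hk := h k
  nlinarith [sq_nonneg ‖kernelFT L f k‖]

end Bochner

section SheetResampling

/-- The generic canonical state for `W = sheetFun L β 0` at half filling IS `halfSheetAmp L β`. [folklore] -/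
theorem jAmp_sheetFun_eq (L : ℕ) [NeZero L] (β : ℝ) : jAmp (sheetFun L β 0) (L ^ 2 / 2) = halfSheetAmp L β := by
  unfold jAmp halfSheetAmp
  rw [sheetKernel_eq_fun]

/-- `jPot (sheetFun L β 0) = sheetPotential L β`. [folklore] -/
theorem jPot_sheetFun_eq (L : ℕ) [NeZero L] (β : ℝ) (u : TorusSite 2 L) (σ : TorusSite 2 L → Fin 2) :
    jPot (sheetFun L β 0) u σ = sheetPotential L β u σ := rfl

/-- `W ≥ 0` for the `c = 0` sheet kernel with `β ≥ 0`. (theory seat Sketch9 Part P `sheetFun_zero_nonneg`) [folklore] -/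
theorem sheetFun_zero_nonneg (L : ℕ) [NeZero L] {β : ℝ} (hβ : 0 ≤ β) (v : TorusSite 2 L) : 0 ≤ sheetFun L β 0 v := by
  unfold sheetFun; split_ifs
  · exact le_rfl
  · exact div_nonneg hβ (latDist_nonneg L v)

/-- `W ≤ β` for the `c = 0` sheet kernel with `β ≥ 0`. [folklore] -/
theorem sheetFun_zero_le (L : ℕ) [NeZero L] {β : ℝ} (hβ : 0 ≤ β) (v : TorusSite 2 L) : sheetFun L β 0 v ≤ β := by
  have h := abs_sheetFun_zero_le L β v
  rw [abs_of_nonneg hβ] at h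
  exact (le_abs_self _).trans h

/-- **`SheetEnergyFloor β E`:** the energy floor for the half-filled min-image sheet gas on every torus `L ≥ 2`
(`= ∀ L, JastrowEnergyFloor (sheetFun L β 0) ⌊L²/2⌋ E`). (theory seat Sketch9 Part P `SheetEnergyFloor`)
[conjecture: theory seat hubbard-h0-rotor-theory-1, cycle 9, 2026-08-28 — memo ROTOR-THEORY-9 §135(t) (⟸ SheetKernelPSD ⟸ SheetKernelSpectralFloor, the residual certified lattice sum K1)] -/
def SheetEnergyFloor (β E : ℝ) : Prop :=
  ∀ (L : ℕ) [NeZero L], 2 ≤ L → JastrowEnergyFloor (sheetFun L β 0) (L ^ 2 / 2) E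

/-- **`SheetKernelPSD β D`:** `W_L + Dδ` positive semidefinite on every torus `L ≥ 2` for the min-image `β/r` kernel.
(theory seat Sketch9 Part P `SheetKernelPSD`)
[conjecture: theory seat hubbard-h0-rotor-theory-1, cycle 9, 2026-08-28 — memo ROTOR-THEORY-9 §135(t) (⟸ SheetKernelSpectralFloor; numerically D = 1.6155·β)] -/
def SheetKernelPSD (β D : ℝ) : Prop :=
  ∀ (L : ℕ) [NeZero L], 2 ≤ L → KernelPSDShift (sheetFun L β 0) D

/-- **Onsager for the sheet (PROVED):** `SheetKernelPSD β D`, `D ≥ 0` ⟹ `SheetEnergyFloor β D`.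
(theory seat Sketch9 Part P `sheetEnergyFloor_of_PSD`) [folklore] -/
theorem sheetEnergyFloor_of_psd {β D : ℝ} (hD : 0 ≤ D) (h : SheetKernelPSD β D) : SheetEnergyFloor β D := by
  intro L _ hL
  have hG : 0 < Fintype.card (TorusSite 2 L) := Fintype.card_pos
  exact jastrowEnergyFloor_of_psd _ (sheetFun_neg L β 0) _ D hD hG (h L hL)

/-- **S2(a) ⟹ PSD (PROVED):** the spectral floor `Ŵ_L(k) ≥ −w₀β` gives `SheetKernelPSD β (w₀β)` (Bochner).
(theory seat Sketch9 Part P″ `sheetKernelPSD_of_spectralFloor`) [folklore] -/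
theorem sheetKernelPSD_of_spectralFloor {w₀ β : ℝ} (hβ : 0 ≤ β) (h : SheetKernelSpectralFloor w₀) :
    SheetKernelPSD β (w₀ * β) := by
  intro L _ _
  refine kernelPSDShift_of_re_kernelFT_ge _ _ fun k => ?_
  have hk := h L β hβ k
  unfold sheetKernelHat at hk
  exact hk

/-- **END-TO-END WITH ONE HYPOTHESIS (PROVED):** the energy floor alone ⟹ uniform BEC of the half-filled min-image
Jastrow–sheet state at that `β ≥ 0`: `e^{−C/2}/4 ≤ n₀/|Λ|` on every even torus `L ≥ 2`, `C = resamplingConst β E`.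
(theory seat Sketch9 Part P′ `condensate_of_energyFloor'`) [folklore] -/
theorem condensate_of_sheetEnergyFloor {β E : ℝ} (hβ : 0 ≤ β) (hE : 0 ≤ E) (hEF : SheetEnergyFloor β E)
    (L : ℕ) [NeZero L] (hL : 2 ≤ L) (hev : Even L) :
    Real.exp (-(resamplingConst β E) / 2) / 4 ≤ condensateDensity (halfSheetAmp L β) := by
  obtain ⟨h1, h2, h3⟩ := halfFilling_numerology L hL
  have hcard : (Fintype.card (TorusSite 2 L) : ℝ) = (L : ℝ) ^ 2 := by
    rw [Fintype.card_fun, ZMod.card, Fintype.card_fin]; push_cast; ring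
  have key := condensateDensity_jAmp_ge_of_energyFloor (sheetFun L β 0) (sheetFun_neg L β 0) (sheetFun_at_zero L β 0)
    (sheetFun_zero_nonneg L hβ) (sheetFun_zero_le L hβ) (L ^ 2 / 2) h1 h2 h3 hE (hEF L hL)
  rw [hcard, jAmp_sheetFun_eq, halfFilling_ratio_even L hL hev] at key
  have : (1 / 2 : ℝ) * (1 - 1 / 2) * Real.exp (-(resamplingConst β E) / 2) = Real.exp (-(resamplingConst β E) / 2) / 4 := by
    ring
  linarith [this ▸ key]

/-- **END-TO-END FROM PSD ALONE (PROVED):** `SheetKernelPSD β D` (`D ≥ 0`) ⟹ uniform BEC, `C = resamplingConst β D`.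
(theory seat Sketch9 Part P′ `condensate_of_PSD'`) [folklore] -/
theorem condensate_of_sheetKernelPSD {β D : ℝ} (hβ : 0 ≤ β) (hD : 0 ≤ D) (hPSD : SheetKernelPSD β D)
    (L : ℕ) [NeZero L] (hL : 2 ≤ L) (hev : Even L) :
    Real.exp (-(resamplingConst β D) / 2) / 4 ≤ condensateDensity (halfSheetAmp L β) :=
  condensate_of_sheetEnergyFloor hβ hD (sheetEnergyFloor_of_psd hD hPSD) L hL hev

/-- **END-TO-END FROM THE SPECTRAL FLOOR (PROVED): the min-image Jastrow–sheet rung with ONE input.**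
`SheetKernelSpectralFloor w₀` (`Ŵ_L(k) ≥ −w₀β` for all `L, k`; numerically `w₀ = 1.6155…`, the 2D Madelung constant
of `1/r` — a certified lattice-sum item) ⟹ for every `β ≥ 0` and every even `L ≥ 2`,
`e^{−C/2}/4 ≤ n₀/|Λ|` for the half-filled `β/r`-Jastrow RK state, `C = resamplingConst β (w₀β)`.
(theory seat Sketch9 Part P″ `condensate_of_spectralFloor`) [folklore] -/
theorem condensate_of_spectralFloor {w₀ β : ℝ} (hw₀ : 0 ≤ w₀) (hβ : 0 ≤ β) (h : SheetKernelSpectralFloor w₀)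
    (L : ℕ) [NeZero L] (hL : 2 ≤ L) (hev : Even L) :
    Real.exp (-(resamplingConst β (w₀ * β)) / 2) / 4 ≤ condensateDensity (halfSheetAmp L β) :=
  condensate_of_sheetKernelPSD hβ (mul_nonneg hw₀ hβ) (sheetKernelPSD_of_spectralFloor hβ h) L hL hev

end SheetResampling

end Summit.HubbardSuperconductivity.HubbardSuperconductivity.Theorems.AnisotropyChord.InsertionEntropy
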